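import Literature.AlgebraicGeometry.Motives.EtaleToProet
import Literature.AlgebraicGeometry.Motives.EtaleToProetHolds
import Literature.AlgebraicGeometry.Motives.EllAdicComparisonLimOneProofs
import HarnessLib

/-!
# Discharged facts: pro-étale vs. étale cohomology with finite coefficients, and the `lim¹` sequence
# for `ℓ`-adic cohomology (Bhatt–Scholze 2015, Cor. 5.1.6 ⇒ Prop. 5.6.2)

Two named facts of the `ℓ`-adic cohomology cluster were reduced in the tree to Bhatt–Scholze,
*The pro-étale topology for schemes*, Cor. 5.1.6 (`nonempty_addEquiv_sheafH_etaleToProetPullback`: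
`H^i(X_ét, F) ≃ H^i(X_proét, ν^* F)` for abelian étale sheaves):

* `nonempty_addEquiv_proetCohomology_etaleCohomology` (`Motives/EllAdicCohomologyFinitenessEtale`:
  `H^i(X_proét, ℤ/n) ≃+ H^i(X_ét, ℤ/n)`), by
  `nonempty_addEquiv_proetCohomology_etaleCohomology_of_pullback` (`Motives/EtaleToProet`);
* `ellAdicCohomology_limOneSequence` (`Motives/EllAdicComparison`: Bhatt–Scholze Prop. 5.6.2, the
  `lim¹` short exact sequence `0 → lim¹ H^{i-1}(X_ét, ℤ/ℓᵐ) → H^i(X_proét, ℤ_ℓ) → lim H^i(X_ét, ℤ/ℓᵐ) → 0`),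
  by `ellAdicCohomology_limOneSequence_of_pullback` (`Motives/EllAdicComparisonLimOneProofs`;
  repleteness, full faithfulness of `ν^*`, `ν^*(ℤ/ℓᵐ) = F_{ℤ/ℓᵐ}` and `lim F_{ℤ/ℓᵐ} = F_{ℤ_ℓ}` being
  proved in that cluster).

Cor. 5.1.6 is a theorem of the tree (`nonempty_addEquiv_sheafH_etaleToProetPullback_holds`,
`Motives/EtaleToProetHolds`: ind-étale faithfully flat covers of weakly étale algebras), so both facts
are discharged by the one-line applications below.  No statement is changed; no definition, no new
named fact (D-0026); net Literature debt **−2**.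

## References

* B. Bhatt, P. Scholze, *The pro-étale topology for schemes*, Astérisque 369 (2015) 99–201:
  Cor. 5.1.6, Prop. 5.6.2 (with Prop. 3.1.9, Lemma 5.1.2, Lemma 4.2.12, Lemma 6.8.2). [BhattScholze2015]
-/

namespace Literature.AlgebraicGeometry.Motives

universe u

/-- **`H^i(X_proét, ℤ/n) ≃+ H^i(X_ét, ℤ/n)` (Bhatt–Scholze Cor. 5.1.6 for `ℤ/n`) — the named fact
`nonempty_addEquiv_proetCohomology_etaleCohomology` holds**
(`nonempty_addEquiv_proetCohomology_etaleCohomology_of_pullback` applied to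
`nonempty_addEquiv_sheafH_etaleToProetPullback_holds`). [cite: BhattScholze2015, Cor. 5.1.6] -/
theorem nonempty_addEquiv_proetCohomology_etaleCohomology_holds :
    nonempty_addEquiv_proetCohomology_etaleCohomology.{u} :=
  nonempty_addEquiv_proetCohomology_etaleCohomology_of_pullback
    nonempty_addEquiv_sheafH_etaleToProetPullback_holds

/-- **Bhatt–Scholze Prop. 5.6.2 (the `lim¹` sequence for `H^i(X_proét, ℤ_ℓ)`) — the named fact
`ellAdicCohomology_limOneSequence` holds** (`ellAdicCohomology_limOneSequence_of_pullback` applied to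
`nonempty_addEquiv_sheafH_etaleToProetPullback_holds`).
[cite: BhattScholze2015, Prop. 5.6.2 and Cor. 5.1.6] -/
theorem ellAdicCohomology_limOneSequence_holds : ellAdicCohomology_limOneSequence.{u} :=
  ellAdicCohomology_limOneSequence_of_pullback nonempty_addEquiv_sheafH_etaleToProetPullback_holds

end Literature.AlgebraicGeometry.Motives
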